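import Mathlib
import HarnessLib
import Summits.CriticalPhenomena.CardyFormulaZ2.Theses.CardySelfRefinement
import Literature.Probability.RandomPlanarGeometry.ChordalReversibility
import Literature.Probability.RandomPlanarGeometry.ConformalRectangle
import Literature.Probability.RandomPlanarGeometry.IsometryCovariance
import Literature.Probability.LatticeModels.DiscreteFaceBoundary
import Literature.Probability.Percolation.FourArmGarbanSquareDomain
import Literature.Probability.Percolation.FineBlocks
import Summits.CriticalPhenomena.CardyFormulaZ2.Theorems.CardySelfRefinementSymmetryUpgradeRTouchWiredArmRegion

/-!
# Lattice geometry of the discrete triangle `Δ_δ`: one mesh component, inner faces, box walks,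
filament tips
(helper for L1 `touchExponent_sepDictionary` of stub `stub_touchExponent`, line `SketchIdeatorTwo`,
crux `SymmetryUpgradeR`, stmt-CriticalPhenomena-17239)

For the triangle `Δ = {re < 0, im < 0, re + im > -1}` (convex) at mesh `δ > 0`:

* `sepDict_mem_tri_iff` — its sites are `x₀ < 0`, `x₁ < 0`, `-1 < δ (x₀ + x₁)`;
* `sepDict_exists_boxWalk` — two sites are joined by a monotone lattice walk through sites of the
  triangle inside their bounding box (east/north to the upper-right corner of the box);
* `sepDict_meshDomain_tri`, `sepDict_tri_adj_iff` — hence the discrete domain `Ω_δ` is the whole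
  set of sites and its edges are the lattice edges between them (convexity);
* `touchExponent_sepDictionary_tri` (registered; = `sepDict_tri_isInnerFace_iff`) — the inner
  faces are `F₀ + 1 < 0`, `F₁ + 1 < 0`, `-1 < δ (F₀ + F₁)` (a staircase polyomino), forcing
  `δ < 1/4` (`sepDict_four_mul_delta_lt`);
* `sepDict_tri_tip` — a site on no inner face is one of the two filament tips at the acute
  corners, one lattice step from a site on an inner face.
-/

noncomputable section

namespace Summit.CriticalPhenomena.CardyFormulaZ2.Theorems.SymmetryUpgradeR.SwallowingSkeleton

open MeasureTheory Filter Set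
open Literature.Probability.RandomPlanarGeometry Literature.Probability.LatticeModels
  Literature.Probability.Percolation
open UpperHalfPlane (upperHalfPlaneSet)
open SimpleGraph DiscreteDobrushin

/-- The triangle `Δ = {re < 0, im < 0, re + im > -1}`. -/
local notation3 "Δ" => ({w : ℂ | w.re < 0 ∧ w.im < 0 ∧ -1 < w.re + w.im} : Set ℂ)

/-! ### Lattice sites of the triangle -/

/-- **The sites of the triangle at mesh `δ`**: `x₀ < 0`, `x₁ < 0`, `-1 < δ (x₀ + x₁)`. -/
theorem sepDict_mem_tri_iff {δ : ℝ} (hδ : 0 < δ) (x : Site 2) :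
    x ∈ meshVertices Δ δ ↔ x 0 < 0 ∧ x 1 < 0 ∧ -1 < δ * ((x 0 : ℝ) + (x 1 : ℝ)) := by
  rw [mem_meshVertices_iff, Set.mem_setOf_eq, meshPoint_re, meshPoint_im]
  have h0 : δ * (x 0 : ℝ) < 0 ↔ x 0 < 0 := by
    rw [mul_neg_iff]
    constructor
    · rintro (⟨-, h⟩ | ⟨h, -⟩)
      · exact_mod_cast h
      · exact absurd h (not_lt.2 hδ.le)
    · intro h; exact Or.inl ⟨hδ, by exact_mod_cast h⟩
  have h1 : δ * (x 1 : ℝ) < 0 ↔ x 1 < 0 := by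
    rw [mul_neg_iff]
    constructor
    · rintro (⟨-, h⟩ | ⟨h, -⟩)
      · exact_mod_cast h
      · exact absurd h (not_lt.2 hδ.le)
    · intro h; exact Or.inl ⟨hδ, by exact_mod_cast h⟩
  rw [h0, h1, mul_add]

/-! ### Straight lattice walks and box walks inside the triangle -/

/-- A straight lattice walk of `n` steps in the direction `cornerUnit k`. -/
theorem sepDict_exists_lineWalk (x : Site 2) (k : Fin 4) :
    ∀ n : ℕ, ∃ p : (zdGraph 2).Walk x (x + (n : ℤ) • cornerUnit k),
      ∀ z ∈ p.support, ∃ m : ℕ, m ≤ n ∧ z = x + (m : ℤ) • cornerUnit k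
  | 0 => ⟨Walk.nil.copy rfl (by simp), fun z hz => ⟨0, le_rfl, by simpa using hz⟩⟩
  | n + 1 => by
    obtain ⟨p, hp⟩ := sepDict_exists_lineWalk x k n
    have hadj : (zdGraph 2).Adj (x + (n : ℤ) • cornerUnit k) (x + ((n + 1 : ℕ) : ℤ) • cornerUnit k) := by
      have := (SimpleGraph.mem_edgeSet _).1 (cSrc_mem_edgeSet (x + (n : ℤ) • cornerUnit k, k))
      have e : x + ((n + 1 : ℕ) : ℤ) • cornerUnit k = x + (n : ℤ) • cornerUnit k + cornerUnit k := by
        push_cast; rw [add_smul, one_smul, add_assoc]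
      rw [e]; exact this
    refine ⟨p.concat hadj, fun z hz => ?_⟩
    rw [Walk.support_concat, List.mem_append, List.mem_singleton] at hz
    rcases hz with hz | rfl
    · obtain ⟨m, hm, rfl⟩ := hp z hz
      exact ⟨m, Nat.le_succ_of_le hm, rfl⟩
    · exact ⟨n + 1, le_rfl, rfl⟩

/-- **The monotone walk to the upper-right corner.** From a site `x` of the triangle to the site
`c` with `x ≤ c` coordinatewise and `c₀, c₁ < 0`: east then north, through sites `z` with
`x ≤ z ≤ c` coordinatewise (all in the triangle). -/
theorem sepDict_exists_cornerWalk {δ : ℝ} (hδ : 0 < δ) {x c : Site 2} (hx : x ∈ meshVertices Δ δ)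
    (h0 : x 0 ≤ c 0) (h1 : x 1 ≤ c 1) (hc0 : c 0 < 0) (hc1 : c 1 < 0) :
    ∃ p : (zdGraph 2).Walk x c, ∀ z ∈ p.support,
      z ∈ meshVertices Δ δ ∧ (x 0 ≤ z 0 ∧ z 0 ≤ c 0) ∧ (x 1 ≤ z 1 ∧ z 1 ≤ c 1) := by
  rw [sepDict_mem_tri_iff hδ] at hx
  obtain ⟨hx0, hx1, hxs⟩ := hx
  -- east to `(c₀, x₁)`, then north to `c`
  obtain ⟨p₁, hp₁⟩ := sepDict_exists_lineWalk x 0 (c 0 - x 0).toNat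
  have hx'0 : (x + ((c 0 - x 0).toNat : ℤ) • cornerUnit 0) 0 = c 0 := by
    rw [(FineBlocks.apply_add_smul_cornerUnit_zero x _).1, Int.toNat_of_nonneg (by omega)]; ring
  have hx'1 : (x + ((c 0 - x 0).toNat : ℤ) • cornerUnit 0) 1 = x 1 :=
    (FineBlocks.apply_add_smul_cornerUnit_zero x _).2
  obtain ⟨p₂, hp₂⟩ := sepDict_exists_lineWalk (x + ((c 0 - x 0).toNat : ℤ) • cornerUnit 0) 1
    (c 1 - x 1).toNat
  have hend : x + ((c 0 - x 0).toNat : ℤ) • cornerUnit 0 + ((c 1 - x 1).toNat : ℤ) • cornerUnit 1 = c := by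
    refine Site.eq_iff_two.2 ⟨?_, ?_⟩
    · rw [(FineBlocks.apply_add_smul_cornerUnit_one _ _).1, hx'0]
    · rw [(FineBlocks.apply_add_smul_cornerUnit_one _ _).2, hx'1, Int.toNat_of_nonneg (by omega)]; ring
  refine ⟨p₁.append (p₂.copy rfl hend), fun z hz => ?_⟩
  rw [Walk.support_append, Walk.support_copy, List.mem_append] at hz
  have key : ∀ z : Site 2, (x 0 ≤ z 0 ∧ z 0 ≤ c 0) → (x 1 ≤ z 1 ∧ z 1 ≤ c 1) →
      z ∈ meshVertices Δ δ ∧ (x 0 ≤ z 0 ∧ z 0 ≤ c 0) ∧ (x 1 ≤ z 1 ∧ z 1 ≤ c 1) := by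
    intro z hz0 hz1
    refine ⟨(sepDict_mem_tri_iff hδ z).2 ⟨by omega, by omega, ?_⟩, hz0, hz1⟩
    have : ((x 0 : ℤ) : ℝ) + ((x 1 : ℤ) : ℝ) ≤ ((z 0 : ℤ) : ℝ) + ((z 1 : ℤ) : ℝ) := by
      exact_mod_cast (show x 0 + x 1 ≤ z 0 + z 1 by omega)
    nlinarith
  rcases hz with hz | hz
  · obtain ⟨m, hm, rfl⟩ := hp₁ z hz
    obtain ⟨e0, e1⟩ := FineBlocks.apply_add_smul_cornerUnit_zero x (m : ℤ)
    refine key _ ⟨by rw [e0]; omega, ?_⟩ ⟨by rw [e1], by rw [e1]; exact h1⟩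
    rw [e0]
    have : (m : ℤ) ≤ (c 0 - x 0).toNat := by exact_mod_cast hm
    rw [Int.toNat_of_nonneg (by omega)] at this
    omega
  · obtain ⟨m, hm, rfl⟩ := hp₂ z (List.mem_of_mem_tail hz)
    obtain ⟨e0, e1⟩ := FineBlocks.apply_add_smul_cornerUnit_one (x + ((c 0 - x 0).toNat : ℤ) • cornerUnit 0) (m : ℤ)
    refine key _ ⟨by rw [e0, hx'0]; exact h0, by rw [e0, hx'0]⟩ ⟨by rw [e1, hx'1]; omega, ?_⟩
    rw [e1, hx'1]
    have : (m : ℤ) ≤ (c 1 - x 1).toNat := by exact_mod_cast hm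
    rw [Int.toNat_of_nonneg (by omega)] at this
    omega

/-- **Box walks in the triangle.** Two sites of the triangle are joined by a lattice walk through
sites of the triangle inside their bounding box (through the upper-right corner of the box,
which lies in the triangle). -/
theorem sepDict_exists_boxWalk {δ : ℝ} (hδ : 0 < δ) {x y : Site 2} (hx : x ∈ meshVertices Δ δ)
    (hy : y ∈ meshVertices Δ δ) :
    ∃ p : (zdGraph 2).Walk x y, ∀ z ∈ p.support, z ∈ meshVertices Δ δ ∧
      (min (x 0) (y 0) ≤ z 0 ∧ z 0 ≤ max (x 0) (y 0)) ∧ (min (x 1) (y 1) ≤ z 1 ∧ z 1 ≤ max (x 1) (y 1)) := by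
  have hx' := (sepDict_mem_tri_iff hδ x).1 hx
  have hy' := (sepDict_mem_tri_iff hδ y).1 hy
  set c : Site 2 := ![max (x 0) (y 0), max (x 1) (y 1)] with hc
  have hc0 : c 0 = max (x 0) (y 0) := rfl
  have hc1 : c 1 = max (x 1) (y 1) := rfl
  obtain ⟨p, hp⟩ := sepDict_exists_cornerWalk hδ hx (c := c) (by rw [hc0]; exact le_max_left _ _)
    (by rw [hc1]; exact le_max_left _ _) (by rw [hc0]; exact max_lt hx'.1 hy'.1)
    (by rw [hc1]; exact max_lt hx'.2.1 hy'.2.1)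
  obtain ⟨q, hq⟩ := sepDict_exists_cornerWalk hδ hy (c := c) (by rw [hc0]; exact le_max_right _ _)
    (by rw [hc1]; exact le_max_right _ _) (by rw [hc0]; exact max_lt hx'.1 hy'.1)
    (by rw [hc1]; exact max_lt hx'.2.1 hy'.2.1)
  refine ⟨p.append q.reverse, fun z hz => ?_⟩
  rw [Walk.support_append, Walk.support_reverse, List.mem_append] at hz
  rcases hz with hz | hz
  · obtain ⟨h1, h2, h3⟩ := hp z hz
    rw [hc0] at h2; rw [hc1] at h3
    exact ⟨h1, ⟨(min_le_left _ _).trans h2.1, h2.2⟩, ⟨(min_le_left _ _).trans h3.1, h3.2⟩⟩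
  · obtain ⟨h1, h2, h3⟩ := hq z (List.mem_reverse.1 (List.mem_of_mem_tail hz))
    rw [hc0] at h2; rw [hc1] at h3
    exact ⟨h1, ⟨(min_le_right _ _).trans h2.1, h2.2⟩, ⟨(min_le_right _ _).trans h3.1, h3.2⟩⟩


/-! ### The discrete triangle: one mesh component, induced adjacency, inner faces -/

/-- A lattice walk through sites of the triangle gives reachability in the mesh graph on the
sites (consecutive sites are joined in the mesh graph by convexity). -/
theorem sepDict_reachable_of_walk {δ : ℝ} {x y : Site 2} (p : (zdGraph 2).Walk x y)
    (hp : ∀ z ∈ p.support, z ∈ meshVertices Δ δ) (hx : x ∈ meshVertices Δ δ) (hy : y ∈ meshVertices Δ δ) :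
    (meshVertexGraph Δ δ).Reachable ⟨x, hx⟩ ⟨y, hy⟩ := by
  induction p with
  | nil => exact Reachable.refl _
  | cons h q ih =>
    rename_i a b c
    have hb : b ∈ meshVertices Δ δ := hp b (by simp)
    have hab : (meshVertexGraph Δ δ).Adj ⟨a, hx⟩ ⟨b, hb⟩ := by
      simp only [SimpleGraph.comap_adj, Function.Embedding.subtype_apply]
      exact touchExponent_meshGraph_adj_tri hx hb h
    exact hab.reachable.trans (ih (fun z hz => hp z (by simp [hz])) hb hy)

/-- **The discrete triangle is the whole set of its sites** (the mesh graph on the sites of the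
convex triangle is connected). -/
theorem sepDict_meshDomain_tri {δ : ℝ} (hδ : 0 < δ) : meshDomain Δ δ = meshVertices Δ δ := by
  refine meshDomain_eq_meshVertices_of_preconnected fun u v => ?_
  obtain ⟨p, hp⟩ := sepDict_exists_boxWalk hδ u.2 v.2
  exact sepDict_reachable_of_walk p (fun z hz => (hp z hz).1) u.2 v.2

/-- **Adjacency in the discrete triangle** is lattice adjacency between its sites. -/
theorem sepDict_tri_adj_iff {δ : ℝ} (hδ : 0 < δ) {x y : Site 2} :
    (discreteDomainGraph Δ δ).Adj x y ↔ (zdGraph 2).Adj x y ∧ x ∈ meshVertices Δ δ ∧ y ∈ meshVertices Δ δ := by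
  rw [discreteDomainGraph_adj_iff, sepDict_meshDomain_tri hδ]
  constructor
  · rintro ⟨h, hx, hy⟩
    exact ⟨(meshGraph_adj_iff.1 h).1, hx, hy⟩
  · rintro ⟨h, hx, hy⟩
    exact ⟨touchExponent_meshGraph_adj_tri hx hy h, hx, hy⟩

/-- A corner of the face `F` has coordinates between those of `F` and `F + (1, 1)`. -/
theorem sepDict_corner_coords {v F : Site 2} (hv : IsCorner v F) :
    (F 0 ≤ v 0 ∧ v 0 ≤ F 0 + 1) ∧ (F 1 ≤ v 1 ∧ v 1 ≤ F 1 + 1) := by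
  constructor
  · rcases hv 0 with h | h <;> omega
  · rcases hv 1 with h | h <;> omega

/-- **The inner faces of the discrete triangle**: the face `F + [0,1]²` is inner iff
`F₀ + 1 < 0`, `F₁ + 1 < 0` and `-1 < δ (F₀ + F₁)` (all four corners are sites of the triangle). -/
theorem sepDict_tri_isInnerFace_iff {E : DiscreteDobrushin}
    (hΩ : E.Ω = {w : ℂ | w.re < 0 ∧ w.im < 0 ∧ -1 < w.re + w.im}) (hδ : 0 < E.δ) (F : Site 2) :
    E.IsInnerFace F ↔ F 0 + 1 < 0 ∧ F 1 + 1 < 0 ∧ -1 < E.δ * ((F 0 : ℝ) + (F 1 : ℝ)) := by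
  unfold DiscreteDobrushin.IsInnerFace
  rw [hΩ]
  constructor
  · intro h
    have hc : IsCorner (F + Pi.single 0 1 + Pi.single 1 1) F := by
      intro i; fin_cases i <;> simp
    have hc' : IsCorner (F + Pi.single 0 1) F := by
      intro i; fin_cases i <;> simp
    have h1 := h _ _ hc hc' ((zdGraph_two_adj_iff_add _ _).2 (Or.inr (Or.inr (Or.inr (by simp)))))
    have h2 := h _ _ (isCorner_self F) hc' ((zdGraph_two_adj_iff_add _ _).2 (Or.inl rfl))
    rw [sepDict_tri_adj_iff hδ] at h1 h2
    have hv := (sepDict_mem_tri_iff hδ _).1 h1.2.1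
    have hF := (sepDict_mem_tri_iff hδ _).1 h2.2.1
    simp only [Pi.add_apply, Pi.single_eq_same, ne_eq, one_ne_zero, not_false_eq_true,
      Pi.single_eq_of_ne, add_zero, zero_ne_one] at hv
    exact ⟨hv.1, hv.2.1, hF.2.2⟩
  · rintro ⟨h0, h1, hs⟩ v w hv hw hvw
    rw [sepDict_tri_adj_iff hδ]
    have key : ∀ u, IsCorner u F → u ∈ meshVertices {w : ℂ | w.re < 0 ∧ w.im < 0 ∧ -1 < w.re + w.im} E.δ := by
      intro u hu
      obtain ⟨hu0, hu1⟩ := sepDict_corner_coords hu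
      refine (sepDict_mem_tri_iff hδ u).2 ⟨by omega, by omega, ?_⟩
      have : ((F 0 : ℤ) : ℝ) + ((F 1 : ℤ) : ℝ) ≤ ((u 0 : ℤ) : ℝ) + ((u 1 : ℤ) : ℝ) := by
        exact_mod_cast (show F 0 + F 1 ≤ u 0 + u 1 by omega)
      nlinarith
    exact ⟨hvw, key v hv, key w hw⟩

/-- An inner face of the discrete triangle forces a mesh below `1/4`. -/
theorem sepDict_four_mul_delta_lt {E : DiscreteDobrushin}
    (hΩ : E.Ω = {w : ℂ | w.re < 0 ∧ w.im < 0 ∧ -1 < w.re + w.im}) (hδ : 0 < E.δ) {F : Site 2}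
    (hF : E.IsInnerFace F) : 4 * E.δ < 1 := by
  obtain ⟨h0, h1, hs⟩ := (sepDict_tri_isInnerFace_iff hΩ hδ F).1 hF
  have : ((F 0 : ℤ) : ℝ) + ((F 1 : ℤ) : ℝ) ≤ -4 := by
    exact_mod_cast (show F 0 + F 1 ≤ -4 by omega)
  nlinarith

/-! ### Boundary sites of the triangle on no inner face: the two filament tips -/

/-- Coordinates of the faces around a vertex. -/
theorem sepDict_faceAt_coords (x : Site 2) :
    ((faceAt x 1) 0 = x 0 - 1 ∧ (faceAt x 1) 1 = x 1) ∧ ((faceAt x 2) 0 = x 0 - 1 ∧ (faceAt x 2) 1 = x 1 - 1) ∧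
    ((faceAt x 3) 0 = x 0 ∧ (faceAt x 3) 1 = x 1 - 1) := by
  refine ⟨⟨?_, ?_⟩, ⟨?_, ?_⟩, ⟨?_, ?_⟩⟩ <;> simp [faceAt, cornerOff, sub_eq_add_neg]

/-- A product `δ u` with `δ > 0` is negative only if `u` is. -/
theorem sepDict_neg_of_mul_neg {δ u : ℝ} (hδ : 0 < δ) (h : δ * u < 0) : u < 0 := by
  rcases mul_neg_iff.1 h with ⟨-, hu⟩ | ⟨hd, -⟩
  · exact hu
  · exact absurd hd (not_lt.2 hδ.le)

/-- **The tips.** A site of the discrete triangle that is a corner of no inner face is one of the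
two filament tips `(-1, t)`, `(t, -1)` at the acute corners; its lattice neighbour towards the
right angle is a site of the triangle on an inner face. (Mesh `δ < 1/4`.) -/
theorem sepDict_tri_tip {E : DiscreteDobrushin}
    (hΩ : E.Ω = {w : ℂ | w.re < 0 ∧ w.im < 0 ∧ -1 < w.re + w.im}) (hδ : 0 < E.δ) (h4 : 4 * E.δ < 1)
    {x : Site 2} (hx : x ∈ meshVertices {w : ℂ | w.re < 0 ∧ w.im < 0 ∧ -1 < w.re + w.im} E.δ)
    (hno : ∀ k, ¬ E.IsInnerFace (faceAt x k)) :
    ∃ k j : Fin 4, x + cornerUnit k ∈ meshVertices {w : ℂ | w.re < 0 ∧ w.im < 0 ∧ -1 < w.re + w.im} E.δ ∧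
      E.IsInnerFace (faceAt (x + cornerUnit k) j) := by
  obtain ⟨hx0, hx1, hxs⟩ := (sepDict_mem_tri_iff hδ x).1 hx
  obtain ⟨⟨f10, f11⟩, ⟨f20, f21⟩, ⟨f30, f31⟩⟩ := sepDict_faceAt_coords x
  have h0 := hno 0
  have h1 := hno 1
  have h2 := hno 2
  have h3 := hno 3
  rw [sepDict_tri_isInnerFace_iff hΩ hδ] at h0 h1 h2 h3
  rw [show faceAt x 0 = x by simp [faceAt, cornerOff]] at h0
  rw [f10, f11] at h1
  rw [f20, f21] at h2
  rw [f30, f31] at h3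
  push_cast at h1 h2 h3
  simp only [mul_add, mul_sub, mul_one] at hxs h0 h1 h2 h3
  -- the diagonal face `x - (1,1)` is not inner: `δ (x₀ + x₁ - 2) ≤ -1`
  have hs2 : E.δ * (x 0 : ℝ) + E.δ * (x 1 : ℝ) - 2 * E.δ ≤ -1 := by
    by_contra h
    exact h2 ⟨by omega, by omega, by linarith⟩
  have hcase : x 0 = -1 ∨ x 1 = -1 := by
    by_contra h
    push Not at h
    exact h0 ⟨by omega, by omega, by linarith⟩
  rcases hcase with e0 | e1
  · -- the tip on the right leg: `x = (-1, x₁)` with `x₁ ≤ -3`; neighbour `x + e₁`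
    have hx0r : E.δ * ((x 0 : ℤ) : ℝ) = -E.δ := by rw [e0]; push_cast; ring
    rw [hx0r] at hxs hs2 h1
    have hx1le : x 1 ≤ -3 := by
      have hne : x 1 ≠ -1 := by
        intro e1
        have : E.δ * ((x 1 : ℤ) : ℝ) = -E.δ := by rw [e1]; push_cast; ring
        rw [this] at hs2
        linarith
      have hb : E.δ * (x 1 : ℝ) - 2 * E.δ ≤ -1 := by
        by_contra h
        exact h1 ⟨by omega, by omega, by linarith⟩
      have hlt : ((x 1 : ℤ) : ℝ) + 2 < 0 :=
        sepDict_neg_of_mul_neg hδ (by linarith)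
      have : x 1 + 2 < 0 := by exact_mod_cast hlt
      omega
    obtain ⟨c0, c1⟩ := FineBlocks.apply_add_smul_cornerUnit_one x 1
    rw [one_smul] at c0 c1
    have hx1r : ((x 1 : ℤ) : ℝ) ≤ -3 := by exact_mod_cast hx1le
    refine ⟨1, 1, (sepDict_mem_tri_iff hδ _).2 ⟨by omega, by omega, ?_⟩, ?_⟩
    · rw [c0, c1, mul_add, hx0r]; push_cast; nlinarith
    · rw [sepDict_tri_isInnerFace_iff hΩ hδ, (sepDict_faceAt_coords _).1.1, (sepDict_faceAt_coords _).1.2,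
        c0, c1, e0]
      push_cast
      exact ⟨by norm_num, by omega, by nlinarith⟩
  · -- the tip on the top leg: `x = (x₀, -1)` with `x₀ ≤ -3`; neighbour `x + e₀`
    have hx1r : E.δ * ((x 1 : ℤ) : ℝ) = -E.δ := by rw [e1]; push_cast; ring
    rw [hx1r] at hxs hs2 h3
    have hx0le : x 0 ≤ -3 := by
      have hne : x 0 ≠ -1 := by
        intro e0
        have : E.δ * ((x 0 : ℤ) : ℝ) = -E.δ := by rw [e0]; push_cast; ring
        rw [this] at hs2
        linarith
      have hb : E.δ * (x 0 : ℝ) - 2 * E.δ ≤ -1 := by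
        by_contra h
        exact h3 ⟨by omega, by omega, by linarith⟩
      have hlt : ((x 0 : ℤ) : ℝ) + 2 < 0 :=
        sepDict_neg_of_mul_neg hδ (by linarith)
      have : x 0 + 2 < 0 := by exact_mod_cast hlt
      omega
    obtain ⟨c0, c1⟩ := FineBlocks.apply_add_smul_cornerUnit_zero x 1
    rw [one_smul] at c0 c1
    have hx0r : ((x 0 : ℤ) : ℝ) ≤ -3 := by exact_mod_cast hx0le
    refine ⟨0, 3, (sepDict_mem_tri_iff hδ _).2 ⟨by omega, by omega, ?_⟩, ?_⟩
    · rw [c0, c1, mul_add, hx1r]; push_cast; nlinarith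
    · rw [sepDict_tri_isInnerFace_iff hΩ hδ, (sepDict_faceAt_coords _).2.2.1, (sepDict_faceAt_coords _).2.2.2,
        c0, c1, e1]
      push_cast
      exact ⟨by omega, by norm_num, by nlinarith⟩


/-- **Registered helper `touchExponent_sepDictionary_tri`** (= `sepDict_tri_isInnerFace_iff`): the
inner faces of the discrete triangle. -/
theorem touchExponent_sepDictionary_tri : ∀ (E : DiscreteDobrushin), E.Ω = {w : ℂ | w.re < 0 ∧ w.im < 0 ∧ -1 < w.re + w.im} → 0 < E.δ → ∀ F : Site 2, E.IsInnerFace F ↔ F 0 + 1 < 0 ∧ F 1 + 1 < 0 ∧ -1 < E.δ * ((F 0 : ℝ) + (F 1 : ℝ)) :=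
  fun _ hΩ hδ F => sepDict_tri_isInnerFace_iff hΩ hδ F

end Summit.CriticalPhenomena.CardyFormulaZ2.Theorems.SymmetryUpgradeR.SwallowingSkeleton

end
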